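import Literature.AlgebraicGeometry.Frobenioids.ArchimedeanFSM
import Literature.AlgebraicGeometry.Frobenioids.ArchimedeanFrobeniusTrivial
import Literature.AlgebraicGeometry.Frobenioids.ArchimedeanMorphismTypes
import Literature.AlgebraicGeometry.Frobenioids.IsometryWideSubcategory
import Mathlib.CategoryTheory.Types.Basic
import HarnessLib

/-!
# Frobenioids II, Proposition 3.4 (v): the TYPED item fails without the total epimorphicity of `D`
# (abc-iut cell, layer L1, node `FrdII:Prop3.4(v)`, sub-node `FrdII:Prop3.4(v)/P34-L06`, chain LC-L1-2)

Mochizuki, *The geometry of Frobenioids II: poly-Frobenioids*, Kyushu J. Math. **62** (2008)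
401–460, §3, Proposition 3.4 (v) p. 30 [cite: MochizukiFrdII2008, Prop 3.4 (v) p.30]; the standing
hypothesis of Example 3.3 (i), p. 27: "Let `D` be a connected, totally epimorphic category".

PROVED here (proof-only file, nothing defined): the typed node statement `ArchFrd.Prop34_v π`, which
quantifies over an ARBITRARY functor `π : D ⥤ D₀` and does not bind the standing hypothesis that `D`
is totally epimorphic, is FALSE at the base `D := Type` (sets and functions), `π :=` the constant
functor at `Spec ℝ`: `not_prop34_v_constReal`. The failing clause is the SECOND projection pattern of
(v) ("projects to an isomorphism of `D`, an irreducible morphism of `F₀`, an isomorphism of `D₀`") in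
the angular Frobenioid `F = A`:
* `X = ((Spec ℝ, [0,1]), ℕ)`; `φ = (ζ₂, id_ℕ) : X → X` with `ζ₂ = (id, 2, 1)` the degree-`2` Frobenius
  endomorphism of the real unit (`C0.frobEndo`), an isometry;
* `φ` projects to `id_ℕ` (an isomorphism of `D`), to `ζ₂` (IRREDUCIBLE in `A₀`: a factor of `ζ₂` in
  `A₀` lies over `Spec ℝ`, and the factor of Frobenius degree `1` is a linear isometry between isotropic
  objects, hence an isomorphism — `A0.isIrreducibleHom_frobEndo_two`), and to `id_{Spec ℝ}`;
* but `φ = α ∘ β` with `β = (ζ₂, n ↦ n+1)`, `α = (id, n ↦ n-1)`, neither of which is an isomorphism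
  (`n ↦ n+1` is not surjective, `n ↦ n-1` is not injective): the identity of `ℕ` factors through a
  non-invertible section/retraction pair, which total epimorphicity forbids ([FrdI] §0 p. 16).
So the printed proof's use of "`D` totally epimorphic" in the second pattern is essential; under that
hypothesis item (v) is PROVED in `ArchimedeanFSMIrreducible.lean` (`prop34_v_of_isTotallyEpimorphic`),
and the first and third patterns hold for every `D`. This is a finding about the TYPING of the node
(a missing binder), not about the printed item; no side is taken on [IUTchIII] Cor. 3.12.
-/

namespace Literature.AlgebraicGeometry.Frobenioids

open CategoryTheory

noncomputable section

namespace ArchFrd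

/-! ### An irreducible arrow of `A₀`: Frobenius degree `2` on the real unit -/

/-- An arrow of `A₀` on the real unit `(Spec ℝ, [0, 1])` of Frobenius degree `2` (e.g. the Frobenius
endomorphism `ζ₂ = (id, 2, 1)`, `C0.frobEndo`) is an IRREDUCIBLE arrow of `A₀`: it is not an isomorphism
(isomorphisms have Frobenius degree `1`), and in a factorisation `a ∘ b` in `A₀` the middle object lies
over `Spec ℝ` (there is no arrow `Spec ℝ → Spec ℂ` in `D₀`), hence is isotropic, and the factor of
Frobenius degree `1` is a linear isometry with invertible base out of an isotropic object, i.e. an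
isomorphism (`C0.isIso_of_isIsotropic`). [cite: MochizukiFrdII2008, Ex 3.3 (iii) p.28] -/
theorem A0.isIrreducibleHom_of_degFr_eq_two (g : (⟨C0.realOfTip 1⟩ : A0) ⟶ ⟨C0.realOfTip 1⟩)
    (hg : C0.degFr g.1 = 2) : IsIrreducibleHom g := by
  have hX : (C0.realOfTip 1).IsNaivelyIsotropic := C0.isNaivelyIsotropic_of_isRealObj rfl
  refine ⟨fun hI => ?_, fun E b a hfac => ?_⟩
  · -- not an isomorphism: its Frobenius degree is `2`
    haveI := hI
    haveI : IsIso g.1 := PreFrobenioid.Isometries.isIso_val g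
    have h1 : C0.degFr g.1 = 1 := (C0.of_isIso g.1).2.1
    rw [hg] at h1
    exact absurd h1 (by decide)
  · obtain ⟨⟨K, A, hA⟩⟩ := E
    cases K with
    | complex => exact (D0.isEmpty_hom_real_complex.false (C0.Base b.1)).elim
    | real =>
      have hE : (⟨D0.real, A, hA⟩ : C0).IsNaivelyIsotropic := hA rfl
      -- Frobenius degrees multiply to `2`
      have hdeg : C0.degFr b.1 * C0.degFr a.1 = 2 := by
        rw [← hg]
        exact congrArg (fun k => C0.degFr (InducedWideCategory.Hom.hom k)) hfac
      have hnat : (C0.degFr b.1 : ℕ) * (C0.degFr a.1 : ℕ) = 2 := by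
        have h := congrArg (fun n : ℕ+ => (n : ℕ)) hdeg
        simpa [PNat.mul_coe] using h
      have hcases : C0.degFr b.1 = 1 ∨ C0.degFr a.1 = 1 := by
        rcases (Nat.dvd_prime Nat.prime_two).mp ⟨_, hnat.symm⟩ with h1 | h2
        · exact Or.inl (PNat.coe_eq_one_iff.mp h1)
        · right
          rw [h2] at hnat
          exact PNat.coe_eq_one_iff.mp (by omega)
      rcases hcases with hb1 | ha1
      · -- `b` has degree `1`: it is an isomorphism
        right
        haveI : IsIso (C0.Base b.1) := by
          rw [D0.hom_real_real_eq_id (C0.Base b.1)]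
          exact ⟨⟨𝟙 _, Category.comp_id _, Category.comp_id _⟩⟩
        haveI : IsIso b.1 :=
          C0.isIso_of_isIsotropic b.1 hX hb1 ((A0.isIsometry_iff_norm_mul_tip_pow _).1 b.2)
        exact PreFrobenioid.Isometries.isIso_of_isIso_val C0.preFrobenioidStructure_holds b
      · -- `a` has degree `1`: it is an isomorphism
        left
        haveI : IsIso (C0.Base a.1) := by
          rw [D0.hom_real_real_eq_id (C0.Base a.1)]
          exact ⟨⟨𝟙 _, Category.comp_id _, Category.comp_id _⟩⟩
        haveI : IsIso a.1 :=
          C0.isIso_of_isIsotropic a.1 hE ha1 ((A0.isIsometry_iff_norm_mul_tip_pow _).1 a.2)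
        exact PreFrobenioid.Isometries.isIso_of_isIso_val C0.preFrobenioidStructure_holds a

/-! ### The counterexample: `D := Type`, `π :=` the constant functor at `Spec ℝ`, `F := A` -/

/-- **Prop. 3.4 (v) as typed fails for `F = A` over `D := Type`, `π := const (Spec ℝ)`**: the arrow
`φ = (ζ₂, id_ℕ)` of the object `((Spec ℝ, [0,1]), ℕ)` projects to the isomorphism `id_ℕ` of `D`, to the
irreducible arrow `ζ₂` of `A₀` and to `id_{Spec ℝ}` in `D₀`, yet `φ = (id, n ↦ n-1) ∘ (ζ₂, n ↦ n+1)` with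
neither factor invertible. [cite: MochizukiFrdII2008, Prop 3.4 (v) p.30] -/
theorem towerA_constReal_not_propV : ¬ (towerA ((Functor.const (Type)).obj D0.real)).PropV := by
  intro h
  have hX0 : (C0.realOfTip 1).IsNaivelyIsotropic := C0.isNaivelyIsotropic_of_isRealObj rfl
  let π : Type ⥤ D0 := (Functor.const (Type)).obj D0.real
  let Xc : C π := ⟨C0.realOfTip 1, ℕ, Iso.refl _⟩
  let X : A π := ⟨Xc⟩
  have hw : ∀ (g0 : C0.realOfTip 1 ⟶ C0.realOfTip 1) (g : ℕ ⟶ ℕ),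
      (PreFrobenioid.baseFunctor C0.toElem).map g0 ≫ Xc.iso.hom = Xc.iso.hom ≫ π.map g :=
    fun g0 g => Subsingleton.elim (α := D0.real ⟶ D0.real) _ _
  let s : ℕ ⟶ ℕ := TypeCat.ofHom fun n : ℕ => n + 1
  let r : ℕ ⟶ ℕ := TypeCat.ofHom fun n : ℕ => n - 1
  let f0 : C0.realOfTip 1 ⟶ C0.realOfTip 1 := C0.frobEndo hX0 2
  have hf0 : PreFrobenioid.IsIsometry C0.toElem f0 := C0.isIsometry_frobEndo hX0 2
  have hisom : ∀ {g0 : C0.realOfTip 1 ⟶ C0.realOfTip 1} (g : ℕ ⟶ ℕ),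
      PreFrobenioid.IsIsometry C0.toElem g0 →
      PreFrobenioid.isometricMorphisms (C.toElem π) (⟨g0, g, hw g0 g⟩ : Xc ⟶ Xc) := by
    intro g0 g hg0
    change pull _ _ (PreFrobenioid.Div C0.toElem g0) = 1
    rw [show PreFrobenioid.Div C0.toElem g0 = 1 from hg0, map_one]
  let φ : X ⟶ X := ⟨⟨f0, 𝟙 ℕ, hw _ _⟩, hisom _ hf0⟩
  let β : X ⟶ X := ⟨⟨f0, s, hw _ _⟩, hisom _ hf0⟩
  let α : X ⟶ X := ⟨⟨𝟙 _, r, hw _ _⟩, hisom _ (PreFrobenioid.div_id C0.toElem _)⟩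
  have hfac : β ≫ α = φ := by
    refine WideSubcategory.hom_ext _ (CFP.hom_ext (Category.comp_id f0) ?_)
    change s ≫ r = 𝟙 ℕ
    exact ConcreteCategory.hom_ext _ _ fun n => by
      change r (s n) = n
      exact Nat.add_sub_cancel n 1
  -- the second projection pattern of (v) applied to `φ`
  have hirr : IsIrreducibleHom φ :=
    (h φ).2.1 (by change IsIso (𝟙 ℕ); infer_instance)
      (A0.isIrreducibleHom_of_degFr_eq_two _ rfl) (by change IsIso (𝟙 D0.real); infer_instance)
  rcases hirr.2 β α hfac with hα | hβ
  · -- `α` invertible ⇒ `n ↦ n - 1` injective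
    have hαC : IsIso α.hom := by haveI := hα; exact PreFrobenioid.Isometries.isIso_val α
    have hr : IsIso r := by haveI := hαC; exact CFP.isIso_snd α.hom
    have hinj := ((CategoryTheory.isIso_iff_bijective r).mp hr).1
    exact absurd (hinj (show r 0 = r 1 from rfl)) (by decide)
  · -- `β` invertible ⇒ `n ↦ n + 1` surjective
    have hβC : IsIso β.hom := by haveI := hβ; exact PreFrobenioid.Isometries.isIso_val β
    have hs : IsIso s := by haveI := hβC; exact CFP.isIso_snd β.hom
    obtain ⟨n, hn⟩ := ((CategoryTheory.isIso_iff_bijective s).mp hs).2 0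
    exact absurd hn (by change n + 1 ≠ 0; omega)

/-- **`Prop34_v` is false as typed** (at `D := Type`, `π := const (Spec ℝ)`; the base `Type` is not
totally epimorphic, so this lies OUTSIDE the standing hypotheses of Ex. 3.3 (i) — the repaired,
hypothesis-binding statement is proved in `ArchimedeanFSMIrreducible.lean`).
[cite: MochizukiFrdII2008, Prop 3.4 (v) p.30] -/
theorem not_prop34_v_constReal : ¬ Prop34_v ((Functor.const (Type)).obj D0.real) :=
  fun h => towerA_constReal_not_propV h.1

end ArchFrd

end

end Literature.AlgebraicGeometry.Frobenioids
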